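import Summits.BirchSwinnertonDyer.BirchSwinnertonDyer.Theorems.KolyvaginDepthDoorMSymbolCertPeriods
import HarnessLib

/-!
# Route `KolyvaginDepthDoor`, crux `KolyvaginDepthSupplyKN` (stmt-BirchSwinnertonDyer-22820) —
# DEPTH TABLE v28, KIT 1′: M-symbols of `Γ₀(N)` for a COMPOSITE level `N = q₁ q₂` (two distinct primes), indexed by
# PAIRS of prime-level indices (`ℙ¹(ℤ/q₁q₂) ≅ ℙ¹(ℤ/q₁) × ℙ¹(ℤ/q₂)`), and their linear relations in index form

Helper file of the lead prover of line `levelone` (kdd-p1 g33; `--supports stmt-BirchSwinnertonDyer-22820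
--as helper`); it closes nothing and BSD is NOT proved by it.

Kit 1 (`…MSymbolCertCosets`, g31) indexes the cosets `SL₂(ℤ)/Γ₀(N) ≅ ℙ¹(ℤ/N)` by `{0, …, N}` for PRIME `N` only
(`idxZ` inverts the first coordinate in the field `ℤ/N`), so the certification lane (computed Kurihara claims →
kernel theorems) could not reach the 10 rank-two curves of composite conductor `< 1000`. This file is the
composite twin for `N = q₁ q₂`, `q₁ ≠ q₂` primes (conductors `446, 655, 681, 707, 718, 794, 817`): by the Chinese
remainder theorem a unimodular column mod `N` is determined up to units by its two reductions, so the PAIR of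
prime-level indices `(idxZ q₁, idxZ q₂)`, packed as `i₁ (q₂ + 1) + i₂ ∈ {0, …, (q₁+1)(q₂+1) − 1}`, indexes `ℙ¹(ℤ/N)`;
every kernel-side function is the corresponding PAIR of kit-1/kit-3 functions at the two primes (no CRT lift is
ever computed: an integer matrix acts on the pair componentwise).
* §1 pair encoding `pairC/fstC/sndC`; computable `idxCN`, `actCN`, `sCN`, `uCN`, `iotaCN`, `chainIdxC`, `chainSumC`.
* §2 (`q₁ ≠ q₂` primes) `idxC`, `colC` (CRT), `colUC`, `mk_eq_mk_colUC` (every unimodular column is equivalent to the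
  column of its index), `eC N i` (the coset of index `i`), `mk_eq_eC`, `actIdxC`, `actP_eC_adjugate`, `inv_smul_eC`,
  `idxC_lt`; the computable twins agree: `idxCN_eq_idxC`, `actCN_eq`, `sCN_eq`, `uCN_eq`, `iotaCN_eq`.
(The relations `relC_*`, `relImC_*` in index form are in the sibling `…MSymbolCertRelationsC`.)

References: [CremonaAlgorithms1997] §2.2 (Prop. 2.2.1, ℙ¹(ℤ/N) for general `N`), §2.4; [PopaZagier2017] Thm. 1, §5.
-/

set_option linter.dupNamespace false

noncomputable section

open scoped MatrixGroups ModularForm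
open CongruenceSubgroup ModularGroup Matrix
open Literature.NumberTheory.EllipticCurves Literature.NumberTheory.EllipticCurves.ModularForms
open Literature.NumberTheory.Automorphic.PopaZagier (coeffN coeff coeff12 coeff12M coeffN_det
  finite_support_coeffN orbT_zeta0_coeffN_eq)

namespace Summit.BirchSwinnertonDyer.BirchSwinnertonDyer.Theorems.KolyvaginDepthDoor.MSymbolCert

/-! ## §1 Pair encoding and the computable layer -/

section CDefs

variable (q₁ q₂ : ℕ)

/-- The packed pair `i₁ (q₂ + 1) + i₂`. [folklore] -/
def pairC (i₁ i₂ : ℕ) : ℕ := i₁ * (q₂ + 1) + i₂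

/-- First component of a packed pair. [folklore] -/
def fstC (i : ℕ) : ℕ := i / (q₂ + 1)

/-- Second component of a packed pair. [folklore] -/
def sndC (i : ℕ) : ℕ := i % (q₂ + 1)

omit q₁ in
/-- `fstC (pairC i₁ i₂) = i₁` for `i₂ ≤ q₂`. [folklore] -/
theorem fstC_pairC {i₁ i₂ : ℕ} (h : i₂ ≤ q₂) : fstC q₂ (pairC q₂ i₁ i₂) = i₁ := by
  unfold fstC pairC
  rw [Nat.add_comm, Nat.add_mul_div_right _ _ (Nat.succ_pos q₂), Nat.div_eq_of_lt (by omega), Nat.zero_add]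

omit q₁ in
/-- `sndC (pairC i₁ i₂) = i₂` for `i₂ ≤ q₂`. [folklore] -/
theorem sndC_pairC {i₁ i₂ : ℕ} (h : i₂ ≤ q₂) : sndC q₂ (pairC q₂ i₁ i₂) = i₂ := by
  unfold sndC pairC
  rw [Nat.add_comm, Nat.add_mul_mod_self_right, Nat.mod_eq_of_lt (by omega)]

omit q₁ in
/-- `sndC i ≤ q₂`. [folklore] -/
theorem sndC_le (i : ℕ) : sndC q₂ i ≤ q₂ := Nat.lt_succ_iff.mp (Nat.mod_lt _ (Nat.succ_pos q₂))

/-- The index of the integer column `(a, c)` modulo `q₁ q₂`: the pair of the kit-3 indices `idxN` at `q₁` and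
at `q₂` (`ℕ`-arithmetic). [cite: CremonaAlgorithms1997, §2.2] -/
def idxCN (a c : ℤ) : ℕ := pairC q₂ (idxN q₁ a c) (idxN q₂ a c)

/-- Componentwise action of an integer matrix (as a quadruple) on packed pairs. [cite: PopaZagier2017, §5] -/
def actCN (B : ℤ × ℤ × ℤ × ℤ) (i : ℕ) : ℕ := pairC q₂ (actN q₁ B (fstC q₂ i)) (actN q₂ B (sndC q₂ i))

/-- Two-term partner (pair of `sN`). [folklore] -/
def sCN (i : ℕ) : ℕ := actCN q₁ q₂ (0, 1, -1, 0) i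

/-- Three-term partner (pair of `uN`). [folklore] -/
def uCN (i : ℕ) : ℕ := actCN q₁ q₂ (0, 1, -1, 1) i

/-- Conjugation partner (pair of `iotaN`). [folklore] -/
def iotaCN (i : ℕ) : ℕ := pairC q₂ (iotaN q₁ (fstC q₂ i)) (iotaN q₂ (sndC q₂ i))

/-- Manin-trick chain of pair indices (as kit 3's `chainIdx`, emitting `idxCN`). [cite: CremonaAlgorithms1997, §2.3] -/
def chainIdxC : ℕ → ℤ → ℤ → List ℕ
  | 0, _, _ => []
  | fuel + 1, z, w => if z = 0 then [] else idxCN q₁ q₂ (w % z) (-z) :: chainIdxC fuel (w % z) (-z)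

/-- The kernel's chain value `∑_{i ∈ chain} φ(i)` at a composite level. [folklore] -/
def chainSumC (φ : ℕ → ℤ) (fuel : ℕ) (z w : ℤ) : ℤ := ((chainIdxC q₁ q₂ fuel z w).map φ).sum

end CDefs

/-! ## §2 `ℙ¹(ℤ/q₁q₂)` by pairs of prime-level indices -/

section CPrime

variable (q₁ q₂ : ℕ) [h₁ : Fact q₁.Prime] [h₂ : Fact q₂.Prime] [hne : Fact (q₁ ≠ q₂)]

/-- Distinct primes are coprime. [folklore] -/
theorem coprimeC : Nat.Coprime q₁ q₂ := (Nat.coprime_primes h₁.out h₂.out).mpr hne.out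

/-- The level `q₁ q₂` is non-zero. [folklore] -/
instance neZero_mulC : NeZero (q₁ * q₂) := ⟨Nat.mul_ne_zero h₁.out.ne_zero h₂.out.ne_zero⟩

/-- Reduction `ℤ/q₁q₂ → ℤ/q₁`. [folklore] -/
def r₁ : ZMod (q₁ * q₂) →+* ZMod q₁ := ZMod.castHom (dvd_mul_right q₁ q₂) (ZMod q₁)

/-- Reduction `ℤ/q₁q₂ → ℤ/q₂`. [folklore] -/
def r₂ : ZMod (q₁ * q₂) →+* ZMod q₂ := ZMod.castHom (dvd_mul_left q₂ q₁) (ZMod q₂)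

/-- The Chinese remainder isomorphism. [folklore] -/
def crt : ZMod (q₁ * q₂) ≃+* ZMod q₁ × ZMod q₂ := ZMod.chineseRemainder (coprimeC q₁ q₂)

/-- The components of the CRT isomorphism are the two reductions. [folklore] -/
theorem crt_apply (x : ZMod (q₁ * q₂)) : crt q₁ q₂ x = (r₁ q₁ q₂ x, r₂ q₁ q₂ x) := by
  change (ZMod.cast x : ZMod q₁ × ZMod q₂) = _
  ext
  · rw [Prod.fst_zmod_cast]; rfl
  · rw [Prod.snd_zmod_cast]; rfl

/-- Two residues mod `q₁ q₂` with the same reductions are equal. [folklore] -/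
theorem eq_of_r_eq {x y : ZMod (q₁ * q₂)} (e₁ : r₁ q₁ q₂ x = r₁ q₁ q₂ y) (e₂ : r₂ q₁ q₂ x = r₂ q₁ q₂ y) :
    x = y := by
  apply (crt q₁ q₂).injective
  rw [crt_apply, crt_apply, e₁, e₂]

omit h₂ hne in
/-- `r₁` of an integer. [folklore] -/
@[simp] theorem r₁_intCast (a : ℤ) : r₁ q₁ q₂ (a : ZMod (q₁ * q₂)) = (a : ZMod q₁) := map_intCast _ a

omit h₁ hne in
/-- `r₂` of an integer. [folklore] -/
@[simp] theorem r₂_intCast (a : ℤ) : r₂ q₁ q₂ (a : ZMod (q₁ * q₂)) = (a : ZMod q₂) := map_intCast _ a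

/-- **The index of the column `(a, c)` modulo `q₁ q₂`**: the packed pair of the kit-1 indices of its reductions.
[cite: CremonaAlgorithms1997, §2.2] -/
def idxC (a c : ZMod (q₁ * q₂)) : ℕ :=
  pairC q₂ (idxZ q₁ (r₁ q₁ q₂ a) (r₁ q₁ q₂ c)) (idxZ q₂ (r₂ q₁ q₂ a) (r₂ q₁ q₂ c))

omit hne in
/-- `idxC < (q₁ + 1)(q₂ + 1)`. [folklore] -/
theorem idxC_lt (a c : ZMod (q₁ * q₂)) : idxC q₁ q₂ a c < (q₁ + 1) * (q₂ + 1) := by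
  unfold idxC pairC
  have ha := idxZ_le q₁ (r₁ q₁ q₂ a) (r₁ q₁ q₂ c)
  have hb := idxZ_le q₂ (r₂ q₁ q₂ a) (r₂ q₁ q₂ c)
  nlinarith

/-- **The column of an index**: the CRT lift of the kit-1 columns `colZ q₁ i₁`, `colZ q₂ i₂`. [cite: CremonaAlgorithms1997, §2.2] -/
def colC (i : ℕ) : Fin 2 → ZMod (q₁ * q₂) := fun j =>
  (crt q₁ q₂).symm (colZ q₁ (fstC q₂ i) j, colZ q₂ (sndC q₂ i) j)

/-- Reduction of `colC` mod `q₁`. [folklore] -/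
theorem r₁_colC (i : ℕ) (j : Fin 2) : r₁ q₁ q₂ (colC q₁ q₂ i j) = colZ q₁ (fstC q₂ i) j := by
  have h := (crt q₁ q₂).apply_symm_apply (colZ q₁ (fstC q₂ i) j, colZ q₂ (sndC q₂ i) j)
  rw [crt_apply] at h
  exact congrArg Prod.fst h

/-- Reduction of `colC` mod `q₂`. [folklore] -/
theorem r₂_colC (i : ℕ) (j : Fin 2) : r₂ q₁ q₂ (colC q₁ q₂ i j) = colZ q₂ (sndC q₂ i) j := by
  have h := (crt q₁ q₂).apply_symm_apply (colZ q₁ (fstC q₂ i) j, colZ q₂ (sndC q₂ i) j)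
  rw [crt_apply] at h
  exact congrArg Prod.snd h

/-- A pair of residues mod `q₁ q₂` is unimodular as soon as both reductions are. [folklore] -/
theorem isCoprime_of_r {x y : ZMod (q₁ * q₂)} (c₁ : IsCoprime (r₁ q₁ q₂ x) (r₁ q₁ q₂ y))
    (c₂ : IsCoprime (r₂ q₁ q₂ x) (r₂ q₁ q₂ y)) : IsCoprime x y := by
  obtain ⟨a₁, b₁, hab₁⟩ := c₁
  obtain ⟨a₂, b₂, hab₂⟩ := c₂
  refine ⟨(crt q₁ q₂).symm (a₁, a₂), (crt q₁ q₂).symm (b₁, b₂), ?_⟩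
  apply (crt q₁ q₂).injective
  rw [map_add, map_mul, map_mul, (crt q₁ q₂).apply_symm_apply, (crt q₁ q₂).apply_symm_apply, map_one,
    crt_apply, crt_apply]
  ext <;> simp [hab₁, hab₂]

/-- `colC i` is unimodular. [folklore] -/
theorem isCoprime_colC (i : ℕ) : IsCoprime (colC q₁ q₂ i 0) (colC q₁ q₂ i 1) := by
  refine isCoprime_of_r q₁ q₂ ?_ ?_
  · rw [r₁_colC, r₁_colC]; exact isCoprime_colZ q₁ _
  · rw [r₂_colC, r₂_colC]; exact isCoprime_colZ q₂ _

/-- `colC i` as a unimodular column. [folklore] -/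
def colUC (i : ℕ) : UniCol (q₁ * q₂) := ⟨colC q₁ q₂ i, isCoprime_colC q₁ q₂ i⟩

/-- **Every unimodular column mod `q₁ q₂` is equivalent to the column of its index** (CRT + kit 1's `mk_eq_mk_colU`
at each prime). [cite: CremonaAlgorithms1997, §2.2 Prop. 2.2.1] -/
theorem mk_eq_mk_colUC (v : UniCol (q₁ * q₂)) :
    P1.mk v = P1.mk (colUC q₁ q₂ (idxC q₁ q₂ (v.1 0) (v.1 1))) := by
  rw [P1.mk_eq_mk_iff]
  change v.1 0 * colC q₁ q₂ _ 1 = v.1 1 * colC q₁ q₂ _ 0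
  have hv₁ : IsCoprime (r₁ q₁ q₂ (v.1 0)) (r₁ q₁ q₂ (v.1 1)) := v.2.map (r₁ q₁ q₂)
  have hv₂ : IsCoprime (r₂ q₁ q₂ (v.1 0)) (r₂ q₁ q₂ (v.1 1)) := v.2.map (r₂ q₁ q₂)
  have k₁ := (P1.mk_eq_mk_iff _ _).mp (mk_eq_mk_colU q₁ ⟨![r₁ q₁ q₂ (v.1 0), r₁ q₁ q₂ (v.1 1)], hv₁⟩)
  have k₂ := (P1.mk_eq_mk_iff _ _).mp (mk_eq_mk_colU q₂ ⟨![r₂ q₁ q₂ (v.1 0), r₂ q₁ q₂ (v.1 1)], hv₂⟩)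
  simp only [colU, Matrix.cons_val_zero, Matrix.cons_val_one, Matrix.cons_val_fin_one] at k₁ k₂
  have i₂le : idxZ q₂ (r₂ q₁ q₂ (v.1 0)) (r₂ q₁ q₂ (v.1 1)) ≤ q₂ := idxZ_le q₂ _ _
  refine eq_of_r_eq q₁ q₂ ?_ ?_
  · rw [map_mul, map_mul, r₁_colC, r₁_colC, idxC, fstC_pairC q₂ i₂le]
    exact k₁
  · rw [map_mul, map_mul, r₂_colC, r₂_colC, idxC, sndC_pairC q₂ i₂le]
    exact k₂

/-- **`eC i`: the coset of `SL₂(ℤ)/Γ₀(q₁q₂)` of index `i`** (through the tree's `cosetEquivP1`).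
[cite: CremonaAlgorithms1997, §2.2] -/
def eC (i : ℕ) : Gamma0Coset (q₁ * q₂) := (cosetEquivP1 (q₁ * q₂)).symm (P1.mk (colUC q₁ q₂ i))

/-- `eC i ↦ [colC i]` under `SL₂(ℤ)/Γ₀ ≅ ℙ¹`. [folklore] -/
theorem cosetEquivP1_eC (i : ℕ) : cosetEquivP1 (q₁ * q₂) (eC q₁ q₂ i) = P1.mk (colUC q₁ q₂ i) :=
  (cosetEquivP1 (q₁ * q₂)).apply_symm_apply _

/-- **Every coset is an `eC i`**: `gΓ₀ = eC (idxC ḡ₀₀ ḡ₁₀)`. [cite: CremonaAlgorithms1997, §2.2 Prop. 2.2.1] -/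
theorem mk_eq_eC (g : SL(2, ℤ)) :
    ((g : Gamma0Coset (q₁ * q₂))) =
      eC q₁ q₂ (idxC q₁ q₂ ((g 0 0 : ℤ) : ZMod (q₁ * q₂)) ((g 1 0 : ℤ) : ZMod (q₁ * q₂))) := by
  apply (cosetEquivP1 (q₁ * q₂)).injective
  rw [cosetEquivP1_mk, cosetEquivP1_eC, colP, mk_eq_mk_colUC]
  rfl

/-- A representative of `eC i` with first column EQUAL to `colC i`. [folklore] -/
theorem exists_rep_eC (i : ℕ) : ∃ g : SL(2, ℤ), firstCol (q₁ * q₂) g = colUC q₁ q₂ i ∧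
    ((g : Gamma0Coset (q₁ * q₂))) = eC q₁ q₂ i := by
  obtain ⟨g, hg⟩ := exists_firstCol_eq (q₁ * q₂) (colUC q₁ q₂ i)
  refine ⟨g, hg, (cosetEquivP1 (q₁ * q₂)).injective ?_⟩
  rw [cosetEquivP1_mk, cosetEquivP1_eC, colP, hg]

/-- The index of `[B̄ · colC i]`. [cite: PopaZagier2017, §5] -/
def actIdxC (B : Matrix (Fin 2) (Fin 2) ℤ) (i : ℕ) : ℕ :=
  idxC q₁ q₂ ((redMat (q₁ * q₂) B *ᵥ colC q₁ q₂ i) 0) ((redMat (q₁ * q₂) B *ᵥ colC q₁ q₂ i) 1)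

/-- **`actP (eC i) (adj B) = eC (actIdxC B i)`** for `det B` prime to `q₁ q₂`. [cite: PopaZagier2017, §5] -/
theorem actP_eC_adjugate {B : Matrix (Fin 2) (Fin 2) ℤ} (hB : IsUnit ((B.det : ℤ) : ZMod (q₁ * q₂))) (i : ℕ) :
    actP (q₁ * q₂) (eC q₁ q₂ i) B.adjugate = eC q₁ q₂ (actIdxC q₁ q₂ B i) := by
  have hB' : IsUnit (redMat (q₁ * q₂) B).det := (isUnit_det_redMat_iff (q₁ * q₂) B).mpr hB
  apply (cosetEquivP1 (q₁ * q₂)).injective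
  rw [cosetEquivP1_actP_adjugate, cosetEquivP1_eC, cosetEquivP1_eC, smulP1_mk (q₁ * q₂) hB', actIdxC]
  exact mk_eq_mk_colUC q₁ q₂ _

/-- **`γ⁻¹ • eC i = eC (actIdxC (adj γ) i)`** for `γ ∈ SL₂(ℤ)`. [cite: PopaZagier2017, §5] -/
theorem inv_smul_eC (γ : SL(2, ℤ)) (i : ℕ) :
    γ⁻¹ • eC q₁ q₂ i = eC q₁ q₂ (actIdxC q₁ q₂ (γ : Matrix (Fin 2) (Fin 2) ℤ).adjugate i) := by
  have hadj : ((γ : Matrix (Fin 2) (Fin 2) ℤ).adjugate).adjugate = (γ : Matrix (Fin 2) (Fin 2) ℤ) := by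
    rw [Matrix.adjugate_adjugate _ (by simp)]
    simp
  have hdet : IsUnit ((((γ : Matrix (Fin 2) (Fin 2) ℤ).adjugate).det : ℤ) : ZMod (q₁ * q₂)) := by
    rw [Matrix.det_adjugate, γ.det_coe]; simp
  rw [← actP_coe, ← hadj, actP_eC_adjugate q₁ q₂ hdet, hadj]

/-! ### The computable layer agrees -/

omit hne in
/-- **`idxCN = idxC`** (kit 3's `idxN_eq_idxZ` at each prime). [folklore] -/
theorem idxCN_eq_idxC (a c : ℤ) :
    idxCN q₁ q₂ a c = idxC q₁ q₂ (a : ZMod (q₁ * q₂)) (c : ZMod (q₁ * q₂)) := by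
  unfold idxCN idxC
  rw [idxN_eq_idxZ, idxN_eq_idxZ, r₁_intCast, r₁_intCast, r₂_intCast, r₂_intCast]

/-- Reduction of `B̄ · colC i` mod `q₁` is `B̄ · colZ q₁ i₁`. [folklore] -/
theorem r₁_mulVec_colC (B : Matrix (Fin 2) (Fin 2) ℤ) (i : ℕ) (j : Fin 2) :
    r₁ q₁ q₂ ((redMat (q₁ * q₂) B *ᵥ colC q₁ q₂ i) j) = (redMat q₁ B *ᵥ colZ q₁ (fstC q₂ i)) j := by
  simp only [Matrix.mulVec, dotProduct, Fin.sum_univ_two, map_add, map_mul, r₁_colC]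
  simp [redMat, r₁]

/-- Reduction of `B̄ · colC i` mod `q₂` is `B̄ · colZ q₂ i₂`. [folklore] -/
theorem r₂_mulVec_colC (B : Matrix (Fin 2) (Fin 2) ℤ) (i : ℕ) (j : Fin 2) :
    r₂ q₁ q₂ ((redMat (q₁ * q₂) B *ᵥ colC q₁ q₂ i) j) = (redMat q₂ B *ᵥ colZ q₂ (sndC q₂ i)) j := by
  simp only [Matrix.mulVec, dotProduct, Fin.sum_univ_two, map_add, map_mul, r₂_colC]
  simp [redMat, r₂]

/-- **`actCN = actIdxC`** on the matrix of the quadruple (kit 3's `actN_eq` at each prime). [folklore] -/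
theorem actCN_eq (B : ℤ × ℤ × ℤ × ℤ) (i : ℕ) : actCN q₁ q₂ B i = actIdxC q₁ q₂ (toMat B) i := by
  unfold actCN actIdxC idxC
  rw [actN_eq, actN_eq, actIdx, actIdx, r₁_mulVec_colC, r₁_mulVec_colC, r₂_mulVec_colC, r₂_mulVec_colC]

/-- `sCN i` is the two-term partner index. [folklore] -/
theorem sCN_eq (i : ℕ) : sCN q₁ q₂ i = actIdxC q₁ q₂ (S : Matrix (Fin 2) (Fin 2) ℤ).adjugate i := by
  rw [sCN, actCN_eq]; congr 1
  simp [toMat, ModularGroup.S, Matrix.adjugate_fin_two]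

/-- `uCN i` is the three-term partner index. [folklore] -/
theorem uCN_eq (i : ℕ) :
    uCN q₁ q₂ i = actIdxC q₁ q₂ ((T : Matrix (Fin 2) (Fin 2) ℤ) * (S : Matrix (Fin 2) (Fin 2) ℤ)).adjugate i := by
  rw [uCN, actCN_eq]; congr 1
  simp [toMat, ModularGroup.S, ModularGroup.T, Matrix.adjugate_fin_two]

/-- `iotaCN i` is the index of the conjugate column `(x, -y)` of `colC i = (x, y)`. [folklore] -/
theorem iotaCN_eq (i : ℕ) : iotaCN q₁ q₂ i = idxC q₁ q₂ (colC q₁ q₂ i 0) (-(colC q₁ q₂ i 1)) := by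
  unfold iotaCN idxC
  rw [iotaN_eq, iotaN_eq, iotaIdx, iotaIdx, map_neg, map_neg, r₁_colC, r₁_colC, r₂_colC, r₂_colC]

end CPrime

end Summit.BirchSwinnertonDyer.BirchSwinnertonDyer.Theorems.KolyvaginDepthDoor.MSymbolCert

end
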